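import Summits.Ventures.HodgeRepro2.T5Multiplicity
import Summits.Ventures.HodgeRepro2.T5AveragedProjection

/-!
# The character multiplicity formula without a unitary hypothesis; multiplicities are well defined

Blind cell `pub-hodge-repro2`, seat p1 (gen 12), Tier-5 kernel support for the representation-theoretic
sentences of `route/T5-SUPPORT-p1.md` §S4.7 («each once» = multiplicity one read off from characters).

`T5Multiplicity.integral_character_mul_conj_eq_card'` counts, for a continuous representation `π` on a
finite-dimensional `V` decomposed as an internal direct sum `S` of irreducible stable subspaces, and an
irreducible unitary `σ`, the summands equivalent to `σ` by the integral `∫ χ_π · conj χ_σ dμ`; only `σ`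
has to be unitary there.  `T5Multiplicity.exists_decomposition_integral_character_eq_card` supplied the
decomposition `S` under the hypothesis `IsUnitary π`.  With the averaged projection
(`T5AveragedProjection.exists_isInternal_irreducible`) the decomposition exists for EVERY continuous
`π`, so:

* `exists_decomposition_integral_character_eq_card` — the unitary-free form: every continuous
  finite-dimensional representation of a compact group has an irreducible internal-direct-sum
  decomposition `S` such that, for every irreducible unitary `σ`, `∫ χ_π · conj χ_σ dμ` is the number of
  summands of `S` equivalent to `σ` (the multiplicity of `σ` in `π`);
* `equivCount_eq_of_isInternal` — the multiplicity does not depend on the decomposition: two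
  irreducible internal-direct-sum decompositions `S`, `S'` of the same `π` contain the same number of
  summands equivalent to `σ` (both numbers equal the integral).

Honest scope (unchanged from the Schur group): compact groups and finite-dimensional representations
only; nothing about U(1,1), its discrete series, or (N).
-/

namespace Summit.Ventures.HodgeRepro2.T5MultiplicityGeneral

open MeasureTheory T5SchurOrthogonality T5CompleteReducibility T5RestrictionRep T5SchurMathlib

variable {G : Type*} [Group G] [TopologicalSpace G] [IsTopologicalGroup G]
  [MeasurableSpace G] [BorelSpace G] [CompactSpace G]
variable {V : Type*} [NormedAddCommGroup V] [InnerProductSpace ℂ V] [FiniteDimensional ℂ V]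
variable (π : G →* V →L[ℂ] V)
variable (μ : Measure G) [IsProbabilityMeasure μ] [μ.IsMulLeftInvariant]

/-- The number of summands of a decomposition `S` (with every summand stable) on which `π` restricts to
a representation equivalent to `σ` — the candidate multiplicity of `σ` in `π` read off from `S`. -/
noncomputable def equivCount {W₀ : Type*} [NormedAddCommGroup W₀] [InnerProductSpace ℂ W₀]
    (σ : G →* W₀ →L[ℂ] W₀) (S : Finset (Submodule ℂ V)) (hst : ∀ W ∈ S, IsStable π W) : ℕ := by
  classical
  exact (Finset.univ.filter fun W : S =>
    Nonempty ((toRep σ).Equiv (toRep (restrictRep π (W : Submodule ℂ V) (hst W W.2))))).card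

/-- **The character multiplicity formula, no unitarity on `π`**: every continuous finite-dimensional
representation `π` of a compact group has an irreducible internal-direct-sum decomposition `S` for
which, for every continuous irreducible unitary `σ`, `∫ χ_π · conj χ_σ dμ = equivCount π σ S hst`.
(The decomposition is `T5AveragedProjection.exists_isInternal_irreducible`; the count is
`T5Multiplicity.integral_character_mul_conj_eq_card'`, which needs only `σ` unitary.) -/
theorem exists_decomposition_integral_character_eq_card (hπ : Continuous π) :
    ∃ S : Finset (Submodule ℂ V), (∀ W ∈ S, IsIrreducibleSubspace π W) ∧
      DirectSum.IsInternal (fun W : S => (W : Submodule ℂ V)) ∧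
      ∃ hst : ∀ W ∈ S, IsStable π W,
        ∀ {W₀ : Type} [NormedAddCommGroup W₀] [InnerProductSpace ℂ W₀] [FiniteDimensional ℂ W₀]
          (σ : G →* W₀ →L[ℂ] W₀), Continuous σ → IsUnitary σ → ∀ [(toRep σ).IsIrreducible],
          ∫ g, character π g * (starRingEnd ℂ) (character σ g) ∂μ =
            (equivCount π σ S hst : ℂ) := by
  classical
  obtain ⟨S, hS, hint⟩ := T5AveragedProjection.exists_isInternal_irreducible μ π hπ
  have hst : ∀ W ∈ S, IsStable π W := fun W hW => (hS W hW).2.1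
  refine ⟨S, hS, hint, hst, ?_⟩
  intro W₀ _ _ _ σ hσ hσu _
  rw [T5Multiplicity.integral_character_mul_conj_eq_card' π σ μ hπ hσ hσu S hS hst hint]
  unfold equivCount
  congr 1

include μ in
/-- **Multiplicities are well defined**: two irreducible internal-direct-sum decompositions `S`, `S'`
of the same continuous `π` contain the same number of summands equivalent to a given continuous
irreducible unitary `σ` (both numbers are `∫ χ_π · conj χ_σ dμ`). -/
theorem equivCount_eq_of_isInternal (hπ : Continuous π) {W₀ : Type*} [NormedAddCommGroup W₀]
    [InnerProductSpace ℂ W₀] [FiniteDimensional ℂ W₀] (σ : G →* W₀ →L[ℂ] W₀) (hσ : Continuous σ)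
    (hσu : IsUnitary σ) [(toRep σ).IsIrreducible]
    (S : Finset (Submodule ℂ V)) (hS : ∀ W ∈ S, IsIrreducibleSubspace π W)
    (hst : ∀ W ∈ S, IsStable π W) (hint : DirectSum.IsInternal (fun W : S => (W : Submodule ℂ V)))
    (S' : Finset (Submodule ℂ V)) (hS' : ∀ W ∈ S', IsIrreducibleSubspace π W)
    (hst' : ∀ W ∈ S', IsStable π W)
    (hint' : DirectSum.IsInternal (fun W : S' => (W : Submodule ℂ V))) :
    equivCount π σ S hst = equivCount π σ S' hst' := by
  classical
  have h := T5Multiplicity.integral_character_mul_conj_eq_card' π σ μ hπ hσ hσu S hS hst hint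
  have h' := T5Multiplicity.integral_character_mul_conj_eq_card' π σ μ hπ hσ hσu S' hS' hst' hint'
  have hc : (equivCount π σ S hst : ℂ) = (equivCount π σ S' hst' : ℂ) := by
    unfold equivCount
    rw [← h, ← h']
  exact_mod_cast hc

end Summit.Ventures.HodgeRepro2.T5MultiplicityGeneral
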